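import Literature.Geometry.Kaehler.ComplexTorusDivisorBorderedHessian
import Literature.Geometry.Kaehler.ComplexTorusDivisorPointMultiplicityTwoTorsion
import Literature.Geometry.Kaehler.ComplexTorusSymmetricDivisorSingularPairs
import HarnessLib

/-!
# The zero locus of `η` on a symmetric theta divisor is stable under `z ↦ −z` and contains the
# 2-division points: at a smooth 2-division point the second fundamental form vanishes identically

[tag: lange-cav-complex-tori] [linked: HodgeConjecture (lit-hodgefound SKELETON §A2, row A2-202)]

Layer `Literature/Geometry/Kaehler`, namespaces `Literature.Geometry.Kaehler.SCV` (§1–§2) and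
`Literature.Geometry.Kaehler.ComplexTorus` (§3); lane `lit-hodgefound` (Track 2 foundations library),
skeleton seat `lit-hodgefound-skel-2` (generation 42), plan row A2-202 (sequel of A2-200
`ComplexTorusDivisorBorderedHessian`: the two remaining clauses of de Jong's Thm. 1.3 about the zero
locus of `η`, for SYMMETRIC divisors `D = (ϑ)`, `ϑ(−v) = s·ϑ(v)` — A2-168/A2-169
`ComplexTorusDivisorPointMultiplicity(TwoTorsion)`, Lange Lemma 2.3.13 / Prop. 2.3.14). Theorems only;
no definition, no named fact.

Sources, VERBATIM. R. de Jong, *Theta functions on the theta divisor*, Rocky Mountain J. Math. 40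
(2010) [held `paper:arxiv-math_0611810`, chunk p0003], after Thm. 1.3: "It follows that for any fixed
`τ`, the zero locus of `η` is well-defined on `Θ`. This zero locus contains `Sing Θ`, the singular locus
of `Θ`, as well as the set of `2`-division points `Θ ∩ A[2]` if `n ≥ 2`. Moreover this zero locus is
stable under the involution `z ↦ −z` of `Θ`." S. Grushevsky, R. Salvati Manni, *The loci of abelian
varieties with points of high multiplicity on the theta divisor*, Geom. Dedicata 139 (2009) [held
`paper:arxiv-0805.4148`, chunk p0010], Remark 19: "the second derivatives of theta automatically vanish
at odd points of order two, but not generically on `𝒜_g`"; chunk p0004 L41: "a characteristic `[ε,δ]`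
is even (resp. odd) if the multiplicity of the theta function `ϑ(τ,z)` at the point `z = (τε+δ)/2` […]".
H. Lange, *Abelian Varieties over the Complex Numbers* (2023), §2.3.4 Lemma 2.3.13 (p. 105: a symmetric
divisor has an even or odd theta function), Prop. 2.3.14 and its proof (p. 106 L1–L12: "`ϑ(−v) =
(−1)^{mult_0(D)} ϑ(v)`", the half-period translate `ϑ̃ = e(−πH(·,u))ϑ(· + u)` of parity
`(−1)^{mult_x(D)} = χ(λ)(−1)^{mult_0(D)}`). D. Eisenbud, J. Harris, *3264 and All That* (2016), Thm. 7.11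
(a) [held chunk p0291]: the tangent hyperplane section has a point of multiplicity `≥ 3` iff the second
fundamental form vanishes.

Mechanism (§2): if an entire `T` satisfies `T(−w) = σ·T(w)` and `dT(0) ≠ 0`, then differentiating once
gives `σ = −1` ("odd point of order two") and differentiating twice gives `D²T(0) = −D²T(0)`, so
`D²T(0) = 0` (Remark 19); the bordered matrix `( 0 l ; ᵗl 0 )` is singular as soon as `n ≥ 2`. On the
torus (§3) `T` is Lange's half-period translate `ϑ̃` of the symmetric `ϑ` at a 2-division point `u`
(`u + u = λ`), `ϑ̃(−w) = sχ(λ)ϑ̃(w)` (tree `translate_half_apply_neg_of_comp_neg_eq`), and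
`D²ϑ̃(0)|_{T×T} = e(−πH(0,u))·D²ϑ(u)|_{T×T}` (A2-197): THE SECOND FUNDAMENTAL FORM OF `D` VANISHES
IDENTICALLY AT EVERY SMOOTH 2-DIVISION POINT, hence `η = 0` there when `g ≥ 2`; the stability under
`z ↦ −z` is `dϑ(−v) = −s·dϑ(v)`, `D²ϑ(−v) = s·D²ϑ(v)`.

## Contents

* §1 (SCV, the reflection `u ↦ −u`) `fderiv_comp_neg_apply`, `fderiv_fderiv_comp_neg_apply`,
  `fderiv_neg_apply_of_comp_neg_eq`, `fderiv_fderiv_neg_apply_of_comp_neg_eq` (`f(−u) = s f(u)` ⟹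
  `df(−v) = −s df(v)`, `D²f(−v) = s D²f(v)`), **`exists_degenerate_neg_iff`** (the second fundamental
  form is degenerate at `−v` iff at `v`), **`neg_mem_setOf_det_borderedHessian_iff`** (DE JONG: THE ZERO
  LOCUS OF `η` ON `{f = 0}` IS STABLE UNDER `v ↦ −v`).
* §2 (SCV, fixed points) **`eq_neg_one_of_comp_neg_eq_const_mul`** (`T(−w) = σT(w)`, `dT(0) ≠ 0` ⟹
  `σ = −1`), **`fderiv_fderiv_zero_eq_zero_of_comp_neg_eq`** (GRUSHEVSKY–SALVATI MANNI REM. 19: THEN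
  `D²T(0) = 0`), `hessianRank_zero_eq_zero_of_comp_neg_eq`, **`det_borderedHessian_zero_eq_zero_of_comp_neg_eq`**
  (`n ≥ 2` ⟹ `η_T(0) = 0`).
* §3 (complex tori, `ϑ(−v) = sϑ(v)` in `|L(H,χ)|`, `u + u = λ ∈ Λ`) `differentiable_translateHalf` /
  `fderiv_translateHalf_zero_apply` (the half-period translate `ϑ̃`),
  **`fderiv_fderiv_apply_eq_zero_of_half_period`** (AT A SMOOTH 2-DIVISION POINT OF A SYMMETRIC DIVISOR
  THE SECOND FUNDAMENTAL FORM `D²ϑ(u)|_{T_{D,x}}` VANISHES IDENTICALLY), `three_le_pointOrder_tangentSection_of_half_period`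
  (its tangent hyperplane section has a point of multiplicity `≥ 3`, EH Thm. 7.11 (a)),
  **`det_borderedHessian_eq_zero_of_half_period`** (DE JONG: `η` VANISHES AT `Θ ∩ X[2]` WHEN `g ≥ 2`),
  `det_borderedHessian_eq_zero_of_half_period_of_image_negDiffeomorph_eq` (the same for a symmetric
  `D = (ϑ)`, `(−1)_X^*D = D`, `χ(Λ) ⊆ {±1}`), **`neg_mem_setOf_det_borderedHessian_iff_thetaFunction`**
  (the zero locus of `η` on a symmetric `D` is `(−1)_X`-stable).

## What is NOT here

Even/odd theta CHARACTERISTICS as such (the statements are for any symmetric `ϑ`); the count of the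
2-division points on `Θ` (A2-170).

## References

* [DeJong2010ThetaFunctionsThetaDivisor] R. de Jong, Rocky Mountain J. Math. 40 (2010), Thm. 1.3 and
  sequel (chunk p0003).
* [GrushevskySalvatiManni2009HighMultiplicity] S. Grushevsky, R. Salvati Manni, Geom. Dedicata 139
  (2009), Remark 19 (chunk p0010), §1 (chunk p0004 L41).
* [Lange2023AbelianVarietiesComplex] H. Lange (2023), §2.3.4 Lemma 2.3.13, Prop. 2.3.14 (pp. 105–106).
* [EisenbudHarris2016] D. Eisenbud, J. Harris, *3264 and All That* (2016), Thm. 7.11 (a) (chunk p0291).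
-/

noncomputable section

open scoped Manifold Topology
open Set Function Module Complex Real

namespace Literature.Geometry.Kaehler

universe u

namespace SCV

variable {E : Type*} [NormedAddCommGroup E] [NormedSpace ℂ E]

/-! ### §1 The reflection `u ↦ −u`: derivatives, degeneracy, the zero locus of `η` -/

section Reflection

/-- `d(f ∘ (−1))(v)(w) = −df(−v)(w)`. [cite: Lange2023AbelianVarietiesComplex, §2.3.4 Lemma 2.3.13 (p. 105)] -/
theorem fderiv_comp_neg_apply {f : E → ℂ} (hf : Differentiable ℂ f) (v w : E) :
    fderiv ℂ (fun u => f (-u)) v w = -fderiv ℂ f (-v) w := by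
  have h : (fun u => f (-u)) = f ∘ ⇑(ContinuousLinearEquiv.neg ℂ : E ≃L[ℂ] E) := by
    funext u
    simp
  rw [h, fderiv_comp v (hf _) (ContinuousLinearEquiv.neg ℂ : E ≃L[ℂ] E).differentiableAt,
    ContinuousLinearEquiv.fderiv, ContinuousLinearMap.comp_apply]
  simp

/-- `D²(f ∘ (−1))(v)(w, w′) = D²f(−v)(w, w′)`. [cite: Lange2023AbelianVarietiesComplex, §2.3.4 Lemma 2.3.13 (p. 105)] [cite: GrushevskySalvatiManni2009HighMultiplicity, Remark 19 (chunk p0010)] -/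
theorem fderiv_fderiv_comp_neg_apply {f : E → ℂ} (hf : Differentiable ℂ f) (v w w' : E) :
    fderiv ℂ (fderiv ℂ (fun u => f (-u))) v w w' = fderiv ℂ (fderiv ℂ f) (-v) w w' := by
  have h := fderiv_fderiv_comp_continuousLinearEquiv_apply (ContinuousLinearEquiv.neg ℂ : E ≃L[ℂ] E) hf v w w'
  simp only [ContinuousLinearEquiv.neg_apply, map_neg, _root_.neg_apply, neg_neg] at h
  exact h

/-- **`f(−u) = s·f(u)` ⟹ `df(−v) = −s·df(v)`.** [cite: Lange2023AbelianVarietiesComplex, §2.3.4 proof of Prop. 2.3.14 (p. 106 L1–L2: "`ϑ(−v) = (−1)^{mult_0(D)}ϑ(v)`")] -/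
theorem fderiv_neg_apply_of_comp_neg_eq {f : E → ℂ} (hf : Differentiable ℂ f) {s : ℂ}
    (hpar : ∀ u, f (-u) = s * f u) (v w : E) : fderiv ℂ f (-v) w = -(s * fderiv ℂ f v w) := by
  have hfun : (fun u => f (-u)) = fun u => s * f u := funext hpar
  have h := congrArg (fun F : E → ℂ => fderiv ℂ F v w) hfun
  simp only [fderiv_comp_neg_apply hf, fderiv_const_mul (hf v) s, _root_.smul_apply, smul_eq_mul] at h
  rw [← h, neg_neg]

/-- **`f(−u) = s·f(u)` ⟹ `D²f(−v) = s·D²f(v)`.** [cite: Lange2023AbelianVarietiesComplex, §2.3.4 Lemma 2.3.13 (p. 105)] [cite: GrushevskySalvatiManni2009HighMultiplicity, Remark 19 (chunk p0010)] -/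
theorem fderiv_fderiv_neg_apply_of_comp_neg_eq {f : E → ℂ} (hf : Differentiable ℂ f) {s : ℂ}
    (hpar : ∀ u, f (-u) = s * f u) (v w w' : E) :
    fderiv ℂ (fderiv ℂ f) (-v) w w' = s * fderiv ℂ (fderiv ℂ f) v w w' := by
  have hfun : (fun u => f (-u)) = fun u => s * f u := funext hpar
  have h1 : fderiv ℂ (fun u => s * f u) = fun x => s • fderiv ℂ f x := funext fun x => fderiv_const_mul (hf x) s
  have h := congrArg (fun F : E → ℂ => fderiv ℂ (fderiv ℂ F) v w w') hfun
  simp only [fderiv_fderiv_comp_neg_apply hf, h1] at h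
  rw [h, show (fun x => s • fderiv ℂ f x) = s • fderiv ℂ f from rfl,
    fderiv_const_smul (hasStrictFDerivAt_fderiv hf v).hasFDerivAt.differentiableAt s,
    _root_.smul_apply, _root_.smul_apply, smul_eq_mul]

/-- **The second fundamental form of `{f = 0}` is degenerate at `−v` iff it is degenerate at `v`** when
`f(−u) = s·f(u)` with `s ≠ 0` (`Ker df(−v) = Ker df(v)`, `D²f(−v) = s·D²f(v)`). [cite: DeJong2010ThetaFunctionsThetaDivisor, Thm. 1.3 sequel (chunk p0003: "stable under the involution `z ↦ −z` of `Θ`")] -/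
theorem exists_degenerate_neg_iff {f : E → ℂ} (hf : Differentiable ℂ f) {s : ℂ} (hs : s ≠ 0)
    (hpar : ∀ u, f (-u) = s * f u) (v : E) :
    (∃ w, w ≠ 0 ∧ fderiv ℂ f (-v) w = 0 ∧ ∀ w', fderiv ℂ f (-v) w' = 0 → fderiv ℂ (fderiv ℂ f) (-v) w w' = 0) ↔
      ∃ w, w ≠ 0 ∧ fderiv ℂ f v w = 0 ∧ ∀ w', fderiv ℂ f v w' = 0 → fderiv ℂ (fderiv ℂ f) v w w' = 0 := by
  have hker : ∀ w, fderiv ℂ f (-v) w = 0 ↔ fderiv ℂ f v w = 0 := fun w => by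
    rw [fderiv_neg_apply_of_comp_neg_eq hf hpar, neg_eq_zero, mul_eq_zero, or_iff_right hs]
  refine exists_congr fun w => and_congr_right fun _ => ?_
  rw [hker w]
  refine and_congr_right fun _ => forall_congr' fun w' => ?_
  rw [hker w', fderiv_fderiv_neg_apply_of_comp_neg_eq hf hpar, mul_eq_zero, or_iff_right hs]

variable {ι' : Type*} [Fintype ι'] [DecidableEq ι']

/-- **DE JONG: "this zero locus is stable under the involution `z ↦ −z`".** For an entire `f` with
`f(−u) = s·f(u)`, `s ≠ 0`, and a basis `b`: `−v` lies in `{f = 0, det B_f = 0}` iff `v` does (A2-200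
`setOf_eq_zero_and_det_borderedHessian_eq_zero_eq`: membership means "singular, or smooth with degenerate
second fundamental form", both reflected by §1). [cite: DeJong2010ThetaFunctionsThetaDivisor, Thm. 1.3 sequel (chunk p0003)] -/
theorem neg_mem_setOf_det_borderedHessian_iff {f : E → ℂ} (hf : Differentiable ℂ f) {s : ℂ} (hs : s ≠ 0)
    (hpar : ∀ u, f (-u) = s * f u) (b : Basis ι' ℂ E) (v : E) :
    -v ∈ {v | f v = 0 ∧
        (Matrix.fromBlocks (Matrix.of fun i j => fderiv ℂ (fderiv ℂ f) v (b i) (b j))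
          (Matrix.of fun i (_ : Unit) => fderiv ℂ f v (b i))
          (Matrix.of fun (_ : Unit) j => fderiv ℂ f v (b j)) (0 : Matrix Unit Unit ℂ)).det = 0} ↔
      v ∈ {v | f v = 0 ∧
        (Matrix.fromBlocks (Matrix.of fun i j => fderiv ℂ (fderiv ℂ f) v (b i) (b j))
          (Matrix.of fun i (_ : Unit) => fderiv ℂ f v (b i))
          (Matrix.of fun (_ : Unit) j => fderiv ℂ f v (b j)) (0 : Matrix Unit Unit ℂ)).det = 0} := by
  rw [setOf_eq_zero_and_det_borderedHessian_eq_zero_eq hf b]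
  have hf0 : f (-v) = 0 ↔ f v = 0 := by rw [hpar, mul_eq_zero, or_iff_right hs]
  have hd : fderiv ℂ f (-v) = 0 ↔ fderiv ℂ f v = 0 := by
    constructor
    · intro h
      ext w
      have hw := fderiv_neg_apply_of_comp_neg_eq hf hpar v w
      rw [h, _root_.zero_apply, eq_comm, neg_eq_zero, mul_eq_zero, or_iff_right hs] at hw
      rw [hw, _root_.zero_apply]
    · intro h
      ext w
      rw [fderiv_neg_apply_of_comp_neg_eq hf hpar, h, _root_.zero_apply, mul_zero, neg_zero]
  simp only [mem_union, mem_setOf_eq, hf0, hd, Ne, exists_degenerate_neg_iff hf hs hpar v]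

end Reflection

/-! ### §2 Fixed points of the reflection: `T(−w) = σ T(w)` with `dT(0) ≠ 0` forces `σ = −1` and
`D²T(0) = 0` -/

section OddPoint

/-- **An "odd point": `T(−w) = σ·T(w)` for all `w` and `dT(0) ≠ 0` force `σ = −1`** (`−dT(0) = σ dT(0)`).
[cite: Lange2023AbelianVarietiesComplex, §2.3.4 Prop. 2.3.14 (p. 106: `(−1)^{mult_x(D)} = χ(λ)(−1)^{mult_0(D)}`, multiplicity one)] [cite: GrushevskySalvatiManni2009HighMultiplicity, §1 (chunk p0004 L41: "even (resp. odd) if the multiplicity […] at the point `z = (τε+δ)/2`") ] -/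
theorem eq_neg_one_of_comp_neg_eq_const_mul {T : E → ℂ} (hT : Differentiable ℂ T) {σ : ℂ}
    (hpar : ∀ w, T (-w) = σ * T w) (hd : fderiv ℂ T 0 ≠ 0) : σ = -1 := by
  obtain ⟨w, hw⟩ : ∃ w, fderiv ℂ T 0 w ≠ 0 := by
    by_contra h
    push Not at h
    exact hd (ContinuousLinearMap.ext fun w => by rw [h w]; rfl)
  have h1 := fderiv_neg_apply_of_comp_neg_eq hT hpar 0 w
  rw [neg_zero] at h1
  -- `a = -(σ a)` with `a ≠ 0`
  have h2 : (σ + 1) * fderiv ℂ T 0 w = 0 := by linear_combination h1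
  rcases mul_eq_zero.1 h2 with h3 | h3
  · linear_combination h3
  · exact absurd h3 hw

/-- **GRUSHEVSKY–SALVATI MANNI, REMARK 19: "the second derivatives of theta automatically vanish at odd
points of order two".** If `T(−w) = σ·T(w)` for all `w` and `dT(0) ≠ 0` then `D²T(0) = 0`
(`σ = −1` and `D²T(0) = σ·D²T(0)`). [cite: GrushevskySalvatiManni2009HighMultiplicity, Remark 19 (chunk p0010)] [cite: DeJong2010ThetaFunctionsThetaDivisor, Thm. 1.3 sequel (chunk p0003: "the set of `2`-division points `Θ ∩ A[2]` if `n ≥ 2`")] -/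
theorem fderiv_fderiv_zero_eq_zero_of_comp_neg_eq {T : E → ℂ} (hT : Differentiable ℂ T) {σ : ℂ}
    (hpar : ∀ w, T (-w) = σ * T w) (hd : fderiv ℂ T 0 ≠ 0) : fderiv ℂ (fderiv ℂ T) 0 = 0 := by
  have hσ : σ = -1 := eq_neg_one_of_comp_neg_eq_const_mul hT hpar hd
  ext w w'
  have h := fderiv_fderiv_neg_apply_of_comp_neg_eq hT hpar 0 w w'
  rw [neg_zero, hσ] at h
  rw [_root_.zero_apply, _root_.zero_apply]
  linear_combination h / 2

/-- … so the Hessian has rank `0` at such a point (the tangent cone of the tangent hyperplane section is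
at least a cubic). [cite: GrushevskySalvatiManni2009HighMultiplicity, Remark 19 (chunk p0010)] -/
theorem hessianRank_zero_eq_zero_of_comp_neg_eq [FiniteDimensional ℂ E] {T : E → ℂ}
    (hT : Differentiable ℂ T) {σ : ℂ} (hpar : ∀ w, T (-w) = σ * T w) (hd : fderiv ℂ T 0 ≠ 0) :
    hessianRank T 0 = 0 := by
  rw [hessianRank_def, fderiv_fderiv_zero_eq_zero_of_comp_neg_eq hT hpar hd]
  simp

variable {ι' : Type*} [Fintype ι'] [DecidableEq ι']

/-- **DE JONG: `η` VANISHES AT AN ODD POINT WHEN `n ≥ 2`.** If `T(−w) = σ·T(w)`, `T(0) = 0` and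
`dim E ≥ 2`, then `det B_T(0) = 0` in every basis: either `dT(0) = 0` (zero border), or `D²T(0) = 0`
(§2) and the `(n−1 ≥ 1)`-dimensional tangent hyperplane carries the ZERO form, which is degenerate.
[cite: DeJong2010ThetaFunctionsThetaDivisor, Thm. 1.3 sequel (chunk p0003: "as well as the set of `2`-division points `Θ ∩ A[2]` if `n ≥ 2`")] [cite: GrushevskySalvatiManni2009HighMultiplicity, Remark 19 (chunk p0010)] -/
theorem det_borderedHessian_zero_eq_zero_of_comp_neg_eq [FiniteDimensional ℂ E] {T : E → ℂ}
    (hT : Differentiable ℂ T) {σ : ℂ} (hpar : ∀ w, T (-w) = σ * T w) (h2 : 2 ≤ finrank ℂ E)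
    (b : Basis ι' ℂ E) :
    (Matrix.fromBlocks (Matrix.of fun i j => fderiv ℂ (fderiv ℂ T) 0 (b i) (b j))
        (Matrix.of fun i (_ : Unit) => fderiv ℂ T 0 (b i))
        (Matrix.of fun (_ : Unit) j => fderiv ℂ T 0 (b j)) (0 : Matrix Unit Unit ℂ)).det = 0 := by
  by_cases hd : fderiv ℂ T 0 = 0
  · exact det_borderedHessian_eq_zero_of_fderiv_eq_zero hd b
  · refine (det_borderedHessian_eq_zero_iff hT b hd).2 ?_
    -- a non-zero tangent vector exists since `dim Ker dT(0) = n − 1 ≥ 1`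
    have hK : 0 < finrank ℂ (LinearMap.ker (fderiv ℂ T 0 : E →ₗ[ℂ] ℂ)) := by
      have h := finrank_ker_add_one hd
      omega
    have hK' : LinearMap.ker (fderiv ℂ T 0 : E →ₗ[ℂ] ℂ) ≠ ⊥ := fun hbot => by
      rw [hbot, finrank_bot] at hK
      exact lt_irrefl _ hK
    obtain ⟨w, hwK, hw0⟩ := (Submodule.ne_bot_iff _).1 hK'
    refine ⟨w, hw0, ?_, fun w' _ => ?_⟩
    · simpa only [LinearMap.mem_ker, ContinuousLinearMap.coe_coe] using hwK
    · rw [fderiv_fderiv_zero_eq_zero_of_comp_neg_eq hT hpar hd, _root_.zero_apply, _root_.zero_apply]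

end OddPoint

end SCV

/-! ### §3 Complex tori: symmetric theta divisors, the involution and the 2-division points -/

namespace ComplexTorus

section Symmetric

variable {ι : Type*} [Fintype ι] {E : Type u} [NormedAddCommGroup E] [InnerProductSpace ℂ E]
  [FiniteDimensional ℂ E] {Φ : (ι → ℝ) ≃L[ℝ] E} {d : ℕ} {n : ℕ} (e : Fin n ≃ ι) (h : 2 * d + 2 = n)
  {η : E [⋀^Fin 2]→L[ℝ] ℝ} {χ : (ι → ℤ) → ℂ} {ι' : Type*} [Fintype ι'] [DecidableEq ι']

omit [Fintype ι] [FiniteDimensional ℂ E] [Fintype ι'] [DecidableEq ι'] in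
/-- The half-period translate `ϑ̃(w) = e(−πH(w,u))·ϑ(w + u)` of an entire `ϑ` is entire.
[cite: Lange2023AbelianVarietiesComplex, §2.3.4 proof of Prop. 2.3.14 (p. 106 L3–L5)] -/
theorem differentiable_translateHalf {ϑ : E → ℂ} (hϑ : Differentiable ℂ ϑ) (u : E) :
    Differentiable ℂ fun w => cexp (-(π * hermOf η w u)) * ϑ (w + u) :=
  (((differentiable_hermOf_left η u).const_mul _).neg).cexp.mul
    (hϑ.comp (differentiable_id.add (differentiable_const u)))

omit [Fintype ι] [FiniteDimensional ℂ E] [Fintype ι'] [DecidableEq ι'] in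
/-- `dϑ̃(0) = e(−πH(0,u))·dϑ(u)` at a zero `u` of `ϑ` (the prefactor is a unit, so `dϑ̃(0) ≠ 0 ⟺
dϑ(u) ≠ 0`). [cite: Lange2023AbelianVarietiesComplex, §2.3.4 proof of Prop. 2.3.14 (p. 106 L3–L5: "`mult_x(D) = mult_0(t_x^*D)`")] -/
theorem fderiv_translateHalf_zero_apply {ϑ : E → ℂ} (hϑ : Differentiable ℂ ϑ) {u : E} (hu0 : ϑ u = 0)
    (w : E) :
    fderiv ℂ (fun w => cexp (-(π * hermOf η w u)) * ϑ (w + u)) 0 w =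
      cexp (-(π * hermOf η 0 u)) * fderiv ℂ ϑ u w := by
  have hd1 : Differentiable ℂ (fun w => ϑ (w + u)) := hϑ.comp (differentiable_id.add (differentiable_const u))
  have hd2 : Differentiable ℂ (fun w => cexp (-(π * hermOf η w u))) :=
    (((differentiable_hermOf_left η u).const_mul _).neg).cexp
  have hF : fderiv ℂ (fun w => ϑ (w + u)) 0 = fderiv ℂ ϑ u := by
    rw [show (fun w => ϑ (w + u)) = fun w => ϑ (w + u) from rfl, fderiv_comp_add_right, zero_add]
  have hmul : fderiv ℂ (fun w => cexp (-(π * hermOf η w u)) * ϑ (w + u)) 0 =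
      cexp (-(π * hermOf η 0 u)) • fderiv ℂ (fun w => ϑ (w + u)) 0 +
        ϑ (0 + u) • fderiv ℂ (fun w => cexp (-(π * hermOf η w u))) 0 :=
    fderiv_mul (hd2 0) (hd1 0)
  rw [hmul, _root_.add_apply, _root_.smul_apply, _root_.smul_apply, smul_eq_mul, smul_eq_mul, zero_add,
    hu0, zero_mul, add_zero, hF]

omit [Fintype ι] [FiniteDimensional ℂ E] [Fintype ι'] [DecidableEq ι'] in
/-- **AT A SMOOTH 2-DIVISION POINT OF A SYMMETRIC DIVISOR THE SECOND FUNDAMENTAL FORM VANISHES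
IDENTICALLY.** Let `ϑ ∈ H⁰(L(H,χ))` satisfy `ϑ(−v) = s·ϑ(v)` (a symmetric divisor, Lemma 2.3.13), let
`u + u = λ ∈ Λ` (`x = π(u) ∈ X[2]`), `ϑ(u) = 0`, `dϑ(u) ≠ 0`. Then `D²ϑ(u)(w, w′) = 0` for all
`w, w′ ∈ T_{D,x} = Ker dϑ(u)`: the half-period translate `ϑ̃` is odd up to the sign `sχ(λ) = −1`, so
`D²ϑ̃(0) = 0` ("the second derivatives of theta automatically vanish at odd points of order two"), and
`D²ϑ̃(0)|_{T×T} = e(−πH(0,u))·D²ϑ(u)|_{T×T}`. [cite: GrushevskySalvatiManni2009HighMultiplicity, Remark 19 (chunk p0010)] [cite: Lange2023AbelianVarietiesComplex, §2.3.4 Prop. 2.3.14 (proof, p. 106 L1–L12)] [cite: DeJong2010ThetaFunctionsThetaDivisor, Thm. 1.3 sequel (chunk p0003)] -/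
theorem fderiv_fderiv_apply_eq_zero_of_half_period {ϑ : E → ℂ}
    (hϑ : ϑ ∈ thetaFunctions Φ (canonicalFactor Φ η χ)) {s : ℂ} (hpar : ∀ v, ϑ (-v) = s * ϑ v)
    (l : ι → ℤ) {u : E} (hu : u + u = latticeVec Φ l) (hu0 : ϑ u = 0) (hd : fderiv ℂ ϑ u ≠ 0)
    {w w' : E} (hw : fderiv ℂ ϑ u w = 0) (hw' : fderiv ℂ ϑ u w' = 0) :
    fderiv ℂ (fderiv ℂ ϑ) u w w' = 0 := by
  have hϑd : Differentiable ℂ ϑ := (mem_thetaFunctions_iff.1 hϑ).1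
  set g : E → ℂ := fun w => cexp (-(π * hermOf η w u)) with hg
  set F : E → ℂ := fun w => ϑ (w + u) with hF
  have hgd : Differentiable ℂ g := (((differentiable_hermOf_left η u).const_mul _).neg).cexp
  have hFd : Differentiable ℂ F := hϑd.comp (differentiable_id.add (differentiable_const u))
  have hTd : Differentiable ℂ (g * F) := hgd.mul hFd
  -- the translate `T = g·F` is odd up to the sign `s χ(l)`
  have hTpar : ∀ w, (g * F) (-w) = s * χ l * (g * F) w := fun w =>
    translate_half_apply_neg_of_comp_neg_eq Φ hϑ hpar l hu w
  have hF0 : F 0 = 0 := by rw [hF]; simp only [zero_add, hu0]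
  have hFd0 : ∀ w, fderiv ℂ F 0 w = fderiv ℂ ϑ u w := fun w => by
    rw [hF, fderiv_comp_add_right, zero_add]
  have hFdd0 : fderiv ℂ (fderiv ℂ F) 0 w w' = fderiv ℂ (fderiv ℂ ϑ) u w w' := by
    rw [hF, show fderiv ℂ (fun w => ϑ (w + u)) = fun x => fderiv ℂ ϑ (x + u) from
      funext fun x => fderiv_comp_add_right u, fderiv_comp_add_right, zero_add]
  -- `dT(0) = g(0) dϑ(u) ≠ 0`
  have hTd0 : fderiv ℂ (g * F) 0 ≠ 0 := by
    intro h0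
    apply hd
    ext w₁
    have h1 := fderiv_translateHalf_zero_apply (η := η) hϑd hu0 w₁
    have h2 : fderiv ℂ (g * F) 0 w₁ = 0 := by rw [h0, _root_.zero_apply]
    change fderiv ℂ (fun w => cexp (-(π * hermOf η w u)) * ϑ (w + u)) 0 w₁ = 0 at h2
    rw [h1, mul_eq_zero, or_iff_right (Complex.exp_ne_zero _)] at h2
    rw [h2, _root_.zero_apply]
  -- Remark 19 for `T`, then strip the unit on `T × T`
  have hT2 : fderiv ℂ (fderiv ℂ (g * F)) 0 w w' = 0 := by
    rw [SCV.fderiv_fderiv_zero_eq_zero_of_comp_neg_eq hTd hTpar hTd0, _root_.zero_apply, _root_.zero_apply]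
  rw [SCV.fderiv_fderiv_mul_apply_of_mem_ker hFd hgd hF0 (by rw [hFd0]; exact hw) (by rw [hFd0]; exact hw'),
    mul_eq_zero, hFdd0] at hT2
  exact hT2.resolve_left (Complex.exp_ne_zero _)

omit [Fintype ι] [FiniteDimensional ℂ E] [Fintype ι'] [DecidableEq ι'] in
/-- … equivalently (EH Thm. 7.11 (a), A2-197): **the tangent hyperplane section of `D` at a smooth
2-division point has a point of multiplicity `≥ 3`.** [cite: EisenbudHarris2016, Thm. 7.11 (a) (chunk p0291)] [cite: GrushevskySalvatiManni2009HighMultiplicity, Remark 19 (chunk p0010)] -/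
theorem three_le_pointOrder_tangentSection_of_half_period {ϑ : E → ℂ}
    (hϑ : ϑ ∈ thetaFunctions Φ (canonicalFactor Φ η χ)) {s : ℂ} (hpar : ∀ v, ϑ (-v) = s * ϑ v)
    (l : ι → ℤ) {u : E} (hu : u + u = latticeVec Φ l) (hu0 : ϑ u = 0) (hd : fderiv ℂ ϑ u ≠ 0) :
    (3 : ℕ∞) ≤ SCV.pointOrder (fun w : LinearMap.ker (fderiv ℂ ϑ u : E →ₗ[ℂ] ℂ) => ϑ (u + (w : E))) 0 :=
  (SCV.three_le_pointOrder_tangentSection_iff (mem_thetaFunctions_iff.1 hϑ).1 hu0).2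
    fun _ hw _ hw' => fderiv_fderiv_apply_eq_zero_of_half_period hϑ hpar l hu hu0 hd hw hw'

omit [Fintype ι] in
/-- **DE JONG: THE ZERO LOCUS OF `η` CONTAINS `Θ ∩ X[2]` WHEN `g ≥ 2`.** For `ϑ ∈ H⁰(L(H,χ))` with
`ϑ(−v) = s·ϑ(v)`, a 2-division point `u + u = λ ∈ Λ` on the divisor (`ϑ(u) = 0`) and `dim V ≥ 2`:
`det B_ϑ(u) = 0` in every basis (singular point: zero border; smooth point: the second fundamental form
is ZERO, so degenerate on the `(g − 1 ≥ 1)`-dimensional tangent hyperplane). [cite: DeJong2010ThetaFunctionsThetaDivisor, Thm. 1.3 sequel (chunk p0003: "This zero locus contains `Sing Θ` […] as well as the set of `2`-division points `Θ ∩ A[2]` if `n ≥ 2`")] [cite: GrushevskySalvatiManni2009HighMultiplicity, Remark 19 (chunk p0010)] -/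
theorem det_borderedHessian_eq_zero_of_half_period {ϑ : E → ℂ}
    (hϑ : ϑ ∈ thetaFunctions Φ (canonicalFactor Φ η χ)) {s : ℂ} (hpar : ∀ v, ϑ (-v) = s * ϑ v)
    (l : ι → ℤ) {u : E} (hu : u + u = latticeVec Φ l) (hu0 : ϑ u = 0) (h2 : 2 ≤ finrank ℂ E)
    (b : Basis ι' ℂ E) :
    (Matrix.fromBlocks (Matrix.of fun i j => fderiv ℂ (fderiv ℂ ϑ) u (b i) (b j))
        (Matrix.of fun i (_ : Unit) => fderiv ℂ ϑ u (b i))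
        (Matrix.of fun (_ : Unit) j => fderiv ℂ ϑ u (b j)) (0 : Matrix Unit Unit ℂ)).det = 0 := by
  have hϑd : Differentiable ℂ ϑ := (mem_thetaFunctions_iff.1 hϑ).1
  by_cases hd : fderiv ℂ ϑ u = 0
  · exact SCV.det_borderedHessian_eq_zero_of_fderiv_eq_zero hd b
  · refine (SCV.det_borderedHessian_eq_zero_iff hϑd b hd).2 ?_
    have hK : 0 < finrank ℂ (LinearMap.ker (fderiv ℂ ϑ u : E →ₗ[ℂ] ℂ)) := by
      have h := SCV.finrank_ker_add_one hd
      omega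
    have hK' : LinearMap.ker (fderiv ℂ ϑ u : E →ₗ[ℂ] ℂ) ≠ ⊥ := fun hbot => by
      rw [hbot, finrank_bot] at hK
      exact lt_irrefl _ hK
    obtain ⟨w, hwK, hw0⟩ := (Submodule.ne_bot_iff _).1 hK'
    have hw : fderiv ℂ ϑ u w = 0 := by
      simpa only [LinearMap.mem_ker, ContinuousLinearMap.coe_coe] using hwK
    exact ⟨w, hw0, hw, fun w' hw' => fderiv_fderiv_apply_eq_zero_of_half_period hϑ hpar l hu hu0 hd hw hw'⟩

include e h in
/-- **The same for a SYMMETRIC divisor `D = (ϑ)`, `(−1)_X^* D = D`, of a symmetric `L(H,χ)`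
(`χ(Λ) ⊆ {±1}`)**: `ϑ(−v) = (−1)^{mult_0(D)}ϑ(v)` (Lemma 2.3.13, A2-168), so `η` vanishes at every
2-division point of `|D|` once `g = d + 1 ≥ 2`. [cite: DeJong2010ThetaFunctionsThetaDivisor, Thm. 1.3 sequel (chunk p0003)] [cite: Lange2023AbelianVarietiesComplex, §2.3.4 Lemma 2.3.13, Prop. 2.3.14 (pp. 105–106)] -/
theorem det_borderedHessian_eq_zero_of_half_period_of_image_negDiffeomorph_eq {r : WithTop ℕ∞} [NeZero r]
    (hη : IsNSForm Φ η) (hχ : IsSemicharacter Φ η χ) (hs : ∀ m, χ m = 1 ∨ χ m = -1) {ϑ : E → ℂ}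
    (hϑ : ϑ ∈ thetaFunctions Φ (canonicalFactor Φ η χ)) (hϑ0 : ϑ ≠ 0)
    (hsym : (divisorChain Φ d ϑ).image (negDiffeomorph Φ r) = divisorChain Φ d ϑ) (hd1 : 1 ≤ d)
    (l : ι → ℤ) {u : E} (hu : u + u = latticeVec Φ l)
    (hu1 : 1 ≤ divisorMultAt Φ d (divisorChain Φ d ϑ) (cover Φ u)) (b : Basis ι' ℂ E) :
    (Matrix.fromBlocks (Matrix.of fun i j => fderiv ℂ (fderiv ℂ ϑ) u (b i) (b j))
        (Matrix.of fun i (_ : Unit) => fderiv ℂ ϑ u (b i))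
        (Matrix.of fun (_ : Unit) j => fderiv ℂ ϑ u (b j)) (0 : Matrix Unit Unit ℂ)).det = 0 := by
  have hpar := apply_neg_eq_neg_one_pow_divisorMultAt_mul e h hη hχ hs hϑ hϑ0 hsym
  have hdim : finrank ℂ E = d + 1 := finrank_eq_succ_of_rank Φ e h
  rw [divisorMultAt_divisorChain_cover e h hη hχ hϑ hϑ0] at hu1
  exact det_borderedHessian_eq_zero_of_half_period hϑ hpar l hu
    ((SCV.one_le_pointOrder_iff (mem_thetaFunctions_iff.1 hϑ).1).1 hu1) (by omega) b

include e h in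
/-- **DE JONG: THE ZERO LOCUS OF `η` ON A SYMMETRIC `D = (ϑ)` IS STABLE UNDER `(−1)_X`** — upstairs:
`−v ∈ {ϑ = 0, det B_ϑ = 0} ⟺ v ∈ {ϑ = 0, det B_ϑ = 0}` (`ϑ(−v) = ±ϑ(v)`, §1). [cite: DeJong2010ThetaFunctionsThetaDivisor, Thm. 1.3 sequel (chunk p0003: "Moreover this zero locus is stable under the involution `z ↦ −z` of `Θ`")] [cite: Lange2023AbelianVarietiesComplex, §2.3.4 Lemma 2.3.13 (p. 105)] -/
theorem neg_mem_setOf_det_borderedHessian_iff_thetaFunction {r : WithTop ℕ∞} [NeZero r]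
    (hη : IsNSForm Φ η) (hχ : IsSemicharacter Φ η χ) (hs : ∀ m, χ m = 1 ∨ χ m = -1) {ϑ : E → ℂ}
    (hϑ : ϑ ∈ thetaFunctions Φ (canonicalFactor Φ η χ)) (hϑ0 : ϑ ≠ 0)
    (hsym : (divisorChain Φ d ϑ).image (negDiffeomorph Φ r) = divisorChain Φ d ϑ) (b : Basis ι' ℂ E)
    (v : E) :
    -v ∈ {v | ϑ v = 0 ∧
        (Matrix.fromBlocks (Matrix.of fun i j => fderiv ℂ (fderiv ℂ ϑ) v (b i) (b j))
          (Matrix.of fun i (_ : Unit) => fderiv ℂ ϑ v (b i))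
          (Matrix.of fun (_ : Unit) j => fderiv ℂ ϑ v (b j)) (0 : Matrix Unit Unit ℂ)).det = 0} ↔
      v ∈ {v | ϑ v = 0 ∧
        (Matrix.fromBlocks (Matrix.of fun i j => fderiv ℂ (fderiv ℂ ϑ) v (b i) (b j))
          (Matrix.of fun i (_ : Unit) => fderiv ℂ ϑ v (b i))
          (Matrix.of fun (_ : Unit) j => fderiv ℂ ϑ v (b j)) (0 : Matrix Unit Unit ℂ)).det = 0} := by
  have hpar := apply_neg_eq_neg_one_pow_divisorMultAt_mul e h hη hχ hs hϑ hϑ0 hsym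
  exact SCV.neg_mem_setOf_det_borderedHessian_iff (mem_thetaFunctions_iff.1 hϑ).1
    (pow_ne_zero _ (by norm_num)) hpar b v

end Symmetric

end ComplexTorus

end Literature.Geometry.Kaehler
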